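import Mathlib
import Literature.MathematicalPhysics.StatisticalMechanics.LennardJonesClusters
import HarnessLib

/-!
# `GappedShellCensus.RadialDefectsVanish` (stmt-AtomisticToContinuum-15930) — the SPLIT glue, STANDALONE form (no route import)

Prover-landed copy (lead c2) of the crux-strategists' standalone glue (s1 `Cruxes/RadialDefectsVanish/SplitGlueStandalone.lean`,
s2 registered stub `radialDefectsVanish_splitGlue` on stmt-15930): the twin of the landed route-importing `RadialDefectsVanish_of_subs`
(`GappedShellCensusRadialDefectsVanishSplit.lean`, p136458) whose module does NOT import the route file, so that
`ledger route edit … --split RadialDefectsVanish --glue-by Summit.AtomisticToContinuum.Crystallization.Theorems.radialDefectsVanish_splitGlue`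
passes the glue.cyclic-import rule.  The three helper lemmas of the route-importing file (`RdvSplit.card_bond_le_twelve`, `gappedTwelve_of_twelve`,
`card_le_mul_card_of_local`) are INLINED as local `have`s (importing them would import the route file; re-declaring them
is a dedup restatement).  Original strategist text follows.

This module deliberately does NOT import the route file (glue.cyclic-import rule of `route edit --glue-by`):
the conclusion of `radialDefectsVanish_splitGlue` is the crux's statement written out LITERALLY (definitionally
the route decl `Summit.AtomisticToContinuum.Crystallization.Theses.GappedShellCensus.RadialDefectsVanish`,
ledger signature of stmt-AtomisticToContinuum-15930), so that after a prover lands this file verbatim as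
`Theorems/GappedShellCensusRadialDefectsVanishSplitGlue.lean` the split can be filed with
`ledger route edit route-AtomisticToContinuum-GappedShellCensus --split RadialDefectsVanish --into children.json --glue-by
Summit.AtomisticToContinuum.Crystallization.Theorems.radialDefectsVanish_splitGlue`.

Strategist decomposition (crux-strategist, 2026-08-17) of the radial crux into three pieces, and the
kernel-checked implication `RadialDefectsVanish_of_subs : TwelveWithinOne → ThickThirteen →
GapBeyondTwelve → RadialDefectsVanish` (hypotheses stated LITERALLY — they are the children of the
split; no new definitions are introduced in this file):

* `TwelveWithinOne` — VERBATIM the one-sided radial crux of route `SquareWellLayerCake`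
  (stmt-AtomisticToContinuum-15808): along every sequence of Lennard-Jones ground states the fraction
  of sites failing [every particle within `11/10` is `55/57`-separated from all others ∧ at least
  twelve particles within distance `1`] tends to `0` (ENERGY, one-sided: only under-coordination and
  compression are charged).
* `ThickThirteen` — at most twelve points of `ℝ³` with norms in `[55/57, 1]` and mutual distances
  `≥ 55/57` (GEOMETRY, theorem-grade: radial projection gives unit vectors at chord `≥ 55/57 = 0.9649 >
  0.957 > 2 sin(δ₁₃/2) = 0.9565`, so it is the strong thirteen-spheres theorem of Musin–Tarasov 2012 in
  thick-shell form, cf. `Literature.Geometry.DiscreteGeometry.musinTarasov2012_tammes_thirteen`).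
* `GapBeyondTwelve` — along every sequence of ground states, for every `θ > 0`, frequently in `N`, at
  most `θN` sites `i` are LOCALLY TWELVE (every site within `7/2` of `x_i`, `x_i` included, has a
  `55/57`-separated `11/10`-neighbourhood and exactly twelve others within `1`) and yet have another site
  at distance in the open annulus `(1, 21/17)` (the Hales-gap clause; NOT one-centre geometry at this
  tolerance — twelve points of the shell `[55/57, 1]`, pairwise `≥ 55/57`, leave room for a 13th point at
  every radius `≥ 1.12` — so it is a k-centre geometric or an energetic statement about minimisers).

Glue: `ThickThirteen` upgrades "≥ 12 within 1" to "exactly 12 within 1" pointwise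
(`card_bond_le_twelve`); a locally-twelve site with no annulus neighbour is gapped-twelve at the
SELECTED scale `a = 50/51` (`gappedTwelve_of_twelve`: bond window `[49/51, 1] ⊇ [55/57, 1]`, gap
`(1, 21/17) = (1.02a, 1.26a)`); sites that are not locally twelve lie within `7/2` of a non-twelve site,
at most `(7/δ₀ + 1)³` of them per non-twelve site by the `δ₀`-separation of ground states
(`LennardJonesMinimalDistance_holds`) and the packing count `card_le_of_separated_of_dist_le`
(`card_le_mul_card_of_local`); `Tendsto`/`Frequently` bookkeeping finishes.  The ground-state hypothesis
is spent inside the two energetic children and on `δ₀` (cf. `radialDefectsVanish_false_without_GS`).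
-/

noncomputable section

open scoped BigOperators Topology Classical
open Filter Finset
open Literature.MathematicalPhysics.StatisticalMechanics

namespace Summit.AtomisticToContinuum.Crystallization.Theorems


/-- **The split glue, standalone form** (registered stub `radialDefectsVanish_splitGlue`; crux-strategist decomposition of
stmt-AtomisticToContinuum-15930; conclusion = the crux statement written out literally, definitionally `GappedShellCensus.RadialDefectsVanish`):
`TwelveWithinOne → ThickThirteen → GapBeyondTwelve → RadialDefectsVanish`, at the selected scale
`a = 50/51`.  The three hypotheses are the children of the split, stated literally (the first is
verbatim `SquareWellLayerCake.TwelveWithinOne`, stmt-AtomisticToContinuum-15808). [folklore] -/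
theorem radialDefectsVanish_splitGlue : ∀ (hK2 : ∀ x : (N : ℕ) → (Fin N → EuclideanSpace ℝ (Fin 3)), (∀ N, Literature.MathematicalPhysics.StatisticalMechanics.IsGroundState Literature.MathematicalPhysics.StatisticalMechanics.lennardJones (x N)) → Filter.Tendsto (fun N : ℕ => (Nat.card {i : Fin N // ¬ ((∀ j : Fin N, dist (x N i) (x N j) ≤ 11 / 10 → ∀ k : Fin N, k ≠ j → (55 : ℝ) / 57 ≤ dist (x N j) (x N k)) ∧ 12 ≤ (Finset.univ.filter fun j : Fin N => j ≠ i ∧ dist (x N i) (x N j) ≤ 1).card)} : ℝ) / N) Filter.atTop (nhds 0)) (hT : ∀ T : Finset (EuclideanSpace ℝ (Fin 3)), (∀ v ∈ T, (55 : ℝ) / 57 ≤ ‖v‖ ∧ ‖v‖ ≤ 1) → (∀ v ∈ T, ∀ w ∈ T, v ≠ w → (55 : ℝ) / 57 ≤ dist v w) → T.card ≤ 12) (hG : ∀ x : (N : ℕ) → (Fin N → EuclideanSpace ℝ (Fin 3)), (∀ N, Literature.MathematicalPhysics.StatisticalMechanics.IsGroundState Literature.MathematicalPhysics.StatisticalMechanics.lennardJones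 (x N)) → ∀ θ : ℝ, 0 < θ → ∃ᶠ N in Filter.atTop, (Nat.card {i : Fin N // (∀ j : Fin N, dist (x N i) (x N j) ≤ 7 / 2 → (∀ k : Fin N, dist (x N j) (x N k) ≤ 11 / 10 → ∀ l : Fin N, l ≠ k → (55 : ℝ) / 57 ≤ dist (x N k) (x N l)) ∧ (Finset.univ.filter fun k : Fin N => k ≠ j ∧ dist (x N j) (x N k) ≤ 1).card = 12) ∧ ∃ j : Fin N, j ≠ i ∧ 1 < dist (x N i) (x N j) ∧ dist (x N i) (x N j) < 21 / 17} : ℝ) ≤ θ * N), (∀ x : (N : ℕ) → (Fin N → EuclideanSpace ℝ (Fin 3)), (∀ N, Literature.MathematicalPhysics.StatisticalMechanics.IsGroundState Literature.MathematicalPhysics.StatisticalMechanics.lennardJones (x N)) → ∃ a : ℝ, 47 / 50 ≤ a ∧ a ≤ 1 ∧ ∀ θ : ℝ, 0 < θ → ∃ᶠ N in Filter.atTop, (Nat.card {i : Fin N // ¬ ((Finset.univ.filter fun j : Fin N => j ≠ i ∧ dist (x N i) (x N j) ≤ a * (1 + 1 / 50)).card = 12 ∧ ∀ j : Fin N, j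 ≠ i → a * (1 - 1 / 50) ≤ dist (x N i) (x N j) ∧ (dist (x N i) (x N j) ≤ a * (1 + 1 / 50) ∨ a * (63 / 50) ≤ dist (x N i) (x N j)))} : ℝ) ≤ θ * N) := by
  intro hK2 hT hG x hx
  have card_bond_le_twelve : ∀ {N : ℕ} (hT : ∀ T : Finset (EuclideanSpace ℝ (Fin 3)), (∀ v ∈ T, (55 : ℝ) / 57 ≤ ‖v‖ ∧ ‖v‖ ≤ 1) → (∀ v ∈ T, ∀ w ∈ T, v ≠ w → (55 : ℝ) / 57 ≤ dist v w) → T.card ≤ 12) (X : Fin N → EuclideanSpace ℝ (Fin 3)) {i : Fin N} (hNb : ∀ j : Fin N, dist (X i) (X j) ≤ 11 / 10 → ∀ k : Fin N, k ≠ j → (55 : ℝ) / 57 ≤ dist (X j) (X k)),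
      (Finset.univ.filter fun j : Fin N => j ≠ i ∧ dist (X i) (X j) ≤ 1).card ≤ 12 := by
      intro N hT X i hNb
      set S := Finset.univ.filter fun j : Fin N => j ≠ i ∧ dist (X i) (X j) ≤ 1 with hS
      have hSepi : ∀ k : Fin N, k ≠ i → (55 : ℝ) / 57 ≤ dist (X i) (X k) :=
        hNb i (by rw [dist_self]; norm_num)
      have hmemS : ∀ j ∈ S, j ≠ i ∧ dist (X i) (X j) ≤ 1 := fun j hj => (Finset.mem_filter.1 hj).2
      have hSepS : ∀ j ∈ S, ∀ k : Fin N, k ≠ j → (55 : ℝ) / 57 ≤ dist (X j) (X k) := fun j hj =>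
        hNb j ((hmemS j hj).2.trans (by norm_num))
      have hinj : Set.InjOn (fun j => X j - X i) (S : Set (Fin N)) := by
        intro j hj j' hj' hjj'
        by_contra hne
        have h1 : (55 : ℝ) / 57 ≤ dist (X j) (X j') := hSepS j hj j' (Ne.symm hne)
        have h2 : X j = X j' := sub_left_inj.1 hjj'
        rw [h2, dist_self] at h1
        norm_num at h1
      have hcard : (S.image fun j => X j - X i).card = S.card := Finset.card_image_of_injOn hinj
      have h12 : (S.image fun j => X j - X i).card ≤ 12 := by
        refine hT _ ?_ ?_
        · intro v hv
          obtain ⟨j, hj, rfl⟩ := Finset.mem_image.1 hv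
          have hji := hmemS j hj
          have hd : ‖X j - X i‖ = dist (X i) (X j) := by rw [dist_comm, dist_eq_norm]
          rw [hd]
          exact ⟨hSepi j hji.1, hji.2⟩
        · intro v hv w hw hvw
          obtain ⟨j, hj, rfl⟩ := Finset.mem_image.1 hv
          obtain ⟨j', hj', rfl⟩ := Finset.mem_image.1 hw
          have hne : j' ≠ j := by
            rintro rfl
            exact hvw rfl
          rw [dist_sub_right]
          exact hSepS j hj j' hne
      rw [hcard] at h12
      exact h12
  have gappedTwelve_of_twelve : ∀ {N : ℕ} (X : Fin N → EuclideanSpace ℝ (Fin 3)) {i : Fin N} (hNb : ∀ j : Fin N, dist (X i) (X j) ≤ 11 / 10 → ∀ k : Fin N, k ≠ j → (55 : ℝ) / 57 ≤ dist (X j) (X k)) (hA : (Finset.univ.filter fun j : Fin N => j ≠ i ∧ dist (X i) (X j) ≤ 1).card = 12) (hAnn : ¬ ∃ j : Fin N, j ≠ i ∧ 1 < dist (X i) (X j) ∧ dist (X i) (X j) < 21 / 17),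
      (Finset.univ.filter fun j : Fin N => j ≠ i ∧ dist (X i) (X j) ≤ 50 / 51 * (1 + 1 / 50)).card = 12 ∧ ∀ j : Fin N, j ≠ i → 50 / 51 * (1 - 1 / 50) ≤ dist (X i) (X j) ∧ (dist (X i) (X j) ≤ 50 / 51 * (1 + 1 / 50) ∨ 50 / 51 * (63 / 50) ≤ dist (X i) (X j)) := by
      intro N X i hNb hA hAnn
      have hSepi : ∀ k : Fin N, k ≠ i → (55 : ℝ) / 57 ≤ dist (X i) (X k) :=
        hNb i (by rw [dist_self]; norm_num)
      have h1 : (50 : ℝ) / 51 * (1 + 1 / 50) = 1 := by norm_num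
      have h2 : (50 : ℝ) / 51 * (63 / 50) = 21 / 17 := by norm_num
      refine ⟨?_, fun j hj => ⟨?_, ?_⟩⟩
      · have hEq : (Finset.univ.filter fun j : Fin N => j ≠ i ∧ dist (X i) (X j) ≤ 50 / 51 * (1 + 1 / 50)) =
            Finset.univ.filter fun j : Fin N => j ≠ i ∧ dist (X i) (X j) ≤ 1 := by
          refine Finset.filter_congr fun j _ => ?_
          rw [h1]
        rw [hEq]
        exact hA
      · have := hSepi j hj
        have h3 : (50 : ℝ) / 51 * (1 - 1 / 50) ≤ 55 / 57 := by norm_num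
        linarith
      · by_cases hd : dist (X i) (X j) ≤ 1
        · left
          rw [h1]
          exact hd
        · right
          rw [h2]
          by_contra hlt
          push Not at hd hlt
          exact hAnn ⟨j, hj, hd, hlt⟩
  have card_le_mul_card_of_local : ∀ {N : ℕ} (X : Fin N → EuclideanSpace ℝ (Fin 3)) (G : Fin N → Prop) {δ : ℝ} (hδ : 0 < δ) (hsep : ∀ i j : Fin N, i ≠ j → δ ≤ dist (X i) (X j)) (SL SB : Finset (Fin N)) (hSL : ∀ i ∈ SL, ¬ ∀ j : Fin N, dist (X i) (X j) ≤ 7 / 2 → G j) (hSB : ∀ j : Fin N, ¬ G j → j ∈ SB),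
      (SL.card : ℝ) ≤ (2 * (7 / 2) / δ + 1) ^ 3 * SB.card := by
      intro N X G δ hδ hsep SL SB hSL hSB
      set ball : Fin N → Finset (Fin N) := fun j =>
        Finset.univ.filter fun i : Fin N => dist (X i) (X j) ≤ 7 / 2 with hball
      have hsub : SL ⊆ SB.biUnion ball := by
        intro i hi
        have h := hSL i hi
        push Not at h
        obtain ⟨j, hj, hg⟩ := h
        refine Finset.mem_biUnion.2 ⟨j, hSB j hg, ?_⟩
        simp only [hball, Finset.mem_filter, Finset.mem_univ, true_and]
        exact hj
      have hinj : Function.Injective X := by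
        intro a b hab
        by_contra hne
        have := hsep a b hne
        rw [hab, dist_self] at this
        linarith
      have hballcard : ∀ j : Fin N, ((ball j).card : ℝ) ≤ (2 * (7 / 2) / δ + 1) ^ 3 := by
        intro j
        have hc : ((ball j).image X).card = (ball j).card := Finset.card_image_of_injective _ hinj
        have h := card_le_of_separated_of_dist_le ((ball j).image X) (X j) hδ
          (by norm_num : (0 : ℝ) ≤ 7 / 2) ?_ ?_
        · rw [hc, finrank_euclideanSpace_fin] at h
          exact h
        · intro c hc'
          obtain ⟨i, hi, rfl⟩ := Finset.mem_image.1 hc'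
          simp only [hball, Finset.mem_filter, Finset.mem_univ, true_and] at hi
          exact hi
        · intro c hc' d hd hcd
          obtain ⟨a, -, rfl⟩ := Finset.mem_image.1 hc'
          obtain ⟨b, -, rfl⟩ := Finset.mem_image.1 hd
          exact hsep a b fun hab => hcd (by rw [hab])
      calc (SL.card : ℝ)
          ≤ ((SB.biUnion ball).card : ℝ) := by exact_mod_cast Finset.card_le_card hsub
        _ ≤ ∑ j ∈ SB, ((ball j).card : ℝ) := by exact_mod_cast Finset.card_biUnion_le
        _ ≤ ∑ j ∈ SB, (2 * (7 / 2) / δ + 1) ^ 3 := Finset.sum_le_sum fun j _ => hballcard j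
        _ = (2 * (7 / 2) / δ + 1) ^ 3 * SB.card := by
            rw [Finset.sum_const, nsmul_eq_mul, mul_comm]
  refine ⟨50 / 51, by norm_num, by norm_num, fun θ hθ => ?_⟩
  obtain ⟨δ₀, hδ₀, hsep⟩ := LennardJonesMinimalDistance_holds
  set K : ℝ := (2 * (7 / 2) / δ₀ + 1) ^ 3 with hK
  have hK1 : 1 ≤ K := by
    have h0 : (0 : ℝ) ≤ 2 * (7 / 2) / δ₀ := by positivity
    have h1 : (1 : ℝ) ≤ 2 * (7 / 2) / δ₀ + 1 := by linarith
    exact one_le_pow₀ h1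
  have hKpos : 0 < K := by linarith
  -- (1) eventually few non-PRE sites (child `TwelveWithinOne`)
  have h1 : ∀ᶠ N in Filter.atTop,
      ((Finset.univ.filter fun i : Fin N => ¬ ((∀ j : Fin N, dist (x N i) (x N j) ≤ 11 / 10 →
        ∀ k : Fin N, k ≠ j → (55 : ℝ) / 57 ≤ dist (x N j) (x N k)) ∧
        12 ≤ (Finset.univ.filter fun j : Fin N => j ≠ i ∧ dist (x N i) (x N j) ≤ 1).card)).card : ℝ) ≤
        θ / (2 * K) * N := by
    have hpos : (0 : ℝ) < θ / (2 * K) := by positivity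
    filter_upwards [(hK2 x hx).eventually (gt_mem_nhds hpos)] with N hN
    rw [Nat.card_eq_fintype_card, Fintype.card_subtype] at hN
    rcases Nat.eq_zero_or_pos N with hN0 | hNpos
    · subst hN0
      simp
    · have hNr : (0 : ℝ) < N := by exact_mod_cast hNpos
      exact ((div_lt_iff₀ hNr).1 hN).le
  -- (2) frequently few locally-twelve sites with an annulus neighbour (child `GapBeyondTwelve`)
  have h2 : ∃ᶠ N in Filter.atTop,
      ((Finset.univ.filter fun i : Fin N =>
        (∀ j : Fin N, dist (x N i) (x N j) ≤ 7 / 2 →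
          (∀ k : Fin N, dist (x N j) (x N k) ≤ 11 / 10 → ∀ l : Fin N, l ≠ k → (55 : ℝ) / 57 ≤ dist (x N k) (x N l)) ∧
          (Finset.univ.filter fun k : Fin N => k ≠ j ∧ dist (x N j) (x N k) ≤ 1).card = 12) ∧
        ∃ j : Fin N, j ≠ i ∧ 1 < dist (x N i) (x N j) ∧ dist (x N i) (x N j) < 21 / 17).card : ℝ) ≤
        θ / 2 * N := by
    refine (hG x hx (θ / 2) (by positivity)).mono fun N hN => ?_
    rw [Nat.card_eq_fintype_card, Fintype.card_subtype] at hN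
    exact hN
  -- (3) combine at a fixed (frequent) `N`
  refine (h2.and_eventually h1).mono ?_
  rintro N ⟨hA, hP⟩
  rw [Nat.card_eq_fintype_card, Fintype.card_subtype]
  have hsepN : ∀ i j : Fin N, i ≠ j → δ₀ ≤ dist (x N i) (x N j) := hsep N (x N) (hx N)
  -- the finsets of this `N`
  set SGT := Finset.univ.filter fun i : Fin N => ¬ ((Finset.univ.filter fun j : Fin N =>
      j ≠ i ∧ dist (x N i) (x N j) ≤ 50 / 51 * (1 + 1 / 50)).card = 12 ∧
      ∀ j : Fin N, j ≠ i → 50 / 51 * (1 - 1 / 50) ≤ dist (x N i) (x N j) ∧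
        (dist (x N i) (x N j) ≤ 50 / 51 * (1 + 1 / 50) ∨ 50 / 51 * (63 / 50) ≤ dist (x N i) (x N j))) with hSGT
  set SA := Finset.univ.filter fun i : Fin N =>
      (∀ j : Fin N, dist (x N i) (x N j) ≤ 7 / 2 →
        (∀ k : Fin N, dist (x N j) (x N k) ≤ 11 / 10 → ∀ l : Fin N, l ≠ k → (55 : ℝ) / 57 ≤ dist (x N k) (x N l)) ∧
        (Finset.univ.filter fun k : Fin N => k ≠ j ∧ dist (x N j) (x N k) ≤ 1).card = 12) ∧
      ∃ j : Fin N, j ≠ i ∧ 1 < dist (x N i) (x N j) ∧ dist (x N i) (x N j) < 21 / 17 with hSA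
  set SP := Finset.univ.filter fun i : Fin N => ¬ ((∀ j : Fin N, dist (x N i) (x N j) ≤ 11 / 10 →
      ∀ k : Fin N, k ≠ j → (55 : ℝ) / 57 ≤ dist (x N j) (x N k)) ∧
      12 ≤ (Finset.univ.filter fun j : Fin N => j ≠ i ∧ dist (x N i) (x N j) ≤ 1).card) with hSP
  set SL := Finset.univ.filter fun i : Fin N => ¬ ∀ j : Fin N, dist (x N i) (x N j) ≤ 7 / 2 →
      ((∀ k : Fin N, dist (x N j) (x N k) ≤ 11 / 10 → ∀ l : Fin N, l ≠ k → (55 : ℝ) / 57 ≤ dist (x N k) (x N l)) ∧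
        (Finset.univ.filter fun k : Fin N => k ≠ j ∧ dist (x N j) (x N k) ≤ 1).card = 12) with hSL
  set SB := Finset.univ.filter fun j : Fin N => ¬ ((∀ k : Fin N, dist (x N j) (x N k) ≤ 11 / 10 →
      ∀ l : Fin N, l ≠ k → (55 : ℝ) / 57 ≤ dist (x N k) (x N l)) ∧
      (Finset.univ.filter fun k : Fin N => k ≠ j ∧ dist (x N j) (x N k) ≤ 1).card = 12) with hSB
  -- (a) not gapped-twelve ⇒ not locally twelve, or locally twelve with an annulus neighbour
  have hGT : (SGT.card : ℝ) ≤ SL.card + SA.card := by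
    have hsub : SGT ⊆ SL ∪ SA := by
      intro i hi
      rw [hSGT, Finset.mem_filter] at hi
      rw [Finset.mem_union, hSL, hSA, Finset.mem_filter, Finset.mem_filter]
      by_cases hL : ∀ j : Fin N, dist (x N i) (x N j) ≤ 7 / 2 →
          ((∀ k : Fin N, dist (x N j) (x N k) ≤ 11 / 10 → ∀ l : Fin N, l ≠ k → (55 : ℝ) / 57 ≤ dist (x N k) (x N l)) ∧
            (Finset.univ.filter fun k : Fin N => k ≠ j ∧ dist (x N j) (x N k) ≤ 1).card = 12)
      · right
        refine ⟨Finset.mem_univ _, hL, ?_⟩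
        by_contra hAnn
        have hGi := hL i (by rw [dist_self]; norm_num)
        exact hi.2 (gappedTwelve_of_twelve (x N) hGi.1 hGi.2 hAnn)
      · left
        exact ⟨Finset.mem_univ _, hL⟩
    exact_mod_cast (Finset.card_le_card hsub).trans (Finset.card_union_le _ _)
  -- (b) spoiled sites are few: packing count around the non-twelve sites
  have hLoc : (SL.card : ℝ) ≤ K * SB.card := by
    refine card_le_mul_card_of_local (x N)
      (fun j : Fin N => (∀ k : Fin N, dist (x N j) (x N k) ≤ 11 / 10 →
          ∀ l : Fin N, l ≠ k → (55 : ℝ) / 57 ≤ dist (x N k) (x N l)) ∧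
        (Finset.univ.filter fun k : Fin N => k ≠ j ∧ dist (x N j) (x N k) ≤ 1).card = 12)
      hδ₀ hsepN SL SB (fun i hi => ?_) (fun j hj => ?_)
    · rw [hSL, Finset.mem_filter] at hi
      exact hi.2
    · rw [hSB, Finset.mem_filter]
      exact ⟨Finset.mem_univ _, hj⟩
  -- (c) non-twelve sites are non-PRE sites (thick thirteen)
  have hGood : (SB.card : ℝ) ≤ SP.card := by
    have hsub : SB ⊆ SP := by
      intro j hj
      rw [hSB, Finset.mem_filter] at hj
      rw [hSP, Finset.mem_filter]
      refine ⟨Finset.mem_univ _, fun hp => hj.2 ⟨hp.1, ?_⟩⟩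
      exact le_antisymm (card_bond_le_twelve hT (x N) hp.1) hp.2
    exact_mod_cast Finset.card_le_card hsub
  have hKθ : K * (θ / (2 * K) * N) = θ / 2 * N := by
    field_simp
  calc (SGT.card : ℝ) ≤ SL.card + SA.card := hGT
    _ ≤ K * SB.card + θ / 2 * N := add_le_add hLoc hA
    _ ≤ K * SP.card + θ / 2 * N := by gcongr
    _ ≤ K * (θ / (2 * K) * N) + θ / 2 * N := by gcongr
    _ = θ * N := by rw [hKθ]; ring

end Summit.AtomisticToContinuum.Crystallization.Theorems

end
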